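import Mathlib
import HarnessLib
import Summits.Ventures.LatticeQCDFlow.Exactness.NCMCGeneralSpaceOccupancyChain

/-!
# The NCMC lane's occupancy chain, continued: the chain watched on the target level estimates target expectations

HONEST FRAMING: exact (Metropolis-corrected) sampling algorithms for lattice gauge theory;
figures of merit are autocorrelation/cost numbers at stated couplings and volumes; no
continuum-physics claim.

Venture `LatticeQCDFlow` (cell pub-lqcd), topic `Exactness`; FANOUT row 13 (`eng-snf`, GEN-17).
NEW WORK of the cell, not a published result; no definition is introduced; nothing is cited as a
fact (Birkhoff's pointwise ergodic theorem enters through `NCMCGeneralSpaceErgodicRun.lean` as a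
tree-PROVED fact).  Named only: Nilmeier–Crooks–Minh–Chodera 2011 (NCMC); the expanded-ensemble
reading (a chain on `{levels} × Ω`) is Lyubartsev et al. 1992 in spirit.

Companion of `NCMCGeneralSpaceOccupancyChain.lean` (same setting: finite level weights `ν₀, ν₁`,
`Z₀ ≠ 0`, a constant `c`, ANY Markov kernel `Q` on `Bool × Ω` leaving the joint weight
`Π_c = jointWeight c ν₀ ν₁` invariant — e.g. one iteration `switchKernel … ∘ₖ levelKernel T₀ T₁` of
`latflow-snf`'s `run_ncmc_chain` — and the chain `Kernel.trajMeasure` of `Q` started in the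
normalised joint law `π_c`).  That file types the reported OCCUPANCY and `dF_occ`; this one types the
engine's other output of the NCMC lane: plain averages of an observable over the iterations spent on
the target level (`snf.ncmc.target_means`, the chain "watched on the target level"), which in
population are target expectations by `NCMCExpandedEnsemble.ncmc_conditional_target` /
`jointWeight` conditioned on the level.

## Content

* `integral_jointWeight_real` — `∫ f dΠ_c = ∫ f(prior, ·) dν₀ + e^{c} ∫ f(target, ·) dν₁`;
  `integral_jointWeight_targetLevel_indicator` (`1_target · g ↦ e^{c} ∫ g dν₁`),
  `integral_jointWeight_priorLevel_indicator` (`1_prior · g ↦ ∫ g dν₀`), `integral_jointLaw`.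
* **`tendsto_targetLevelMean_ae_chain`** — IF the chain is ergodic for the shift: for every measurable
  `ν₁`-integrable `g`, `Σ_{i<n, level_i = target} g(x_i) / #{i<n : level_i = target} → Z₁⁻¹ ∫ g dν₁`
  almost surely (a ratio of two ergodic averages, `NCMCGeneralSpaceErgodicRun.tendsto_ratio_ae_of_ergodic`);
  **`tendsto_priorLevelMean_ae_chain`** — the same on the prior level, limit `Z₀⁻¹ ∫ g dν₀`.

The ergodicity hypothesis is discharged for the engine's iteration kernel in
`NCMCGeneralSpaceOccupancyChainErgodic.lean`.  NOT CLAIMED: rates or error bars for these ratio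
estimators; anything about a concrete protocol.
-/

namespace Summit.Ventures.LatticeQCDFlow.Exactness.GeneralNCMC

open MeasureTheory ProbabilityTheory Set Filter Finset
open scoped ENNReal Topology

variable {Ω : Type*} [MeasurableSpace Ω]

/-! ## The normalised joint law `π_c` -/

section JointLaw

variable (c : ℝ) (ν₀ ν₁ : Measure Ω)

/-- The joint weight of finite level weights is finite: `Π_c(everything) = Z₀ + e^{c} Z₁ < ∞`. -/
theorem integral_jointWeight_real {f : Bool × Ω → ℝ}
    (hf : Measurable f) (hf0 : Integrable (fun x => f (false, x)) ν₀)
    (hf1 : Integrable (fun y => f (true, y)) ν₁) :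
    ∫ p, f p ∂(jointWeight c ν₀ ν₁) =
      ∫ x, f (false, x) ∂ν₀ + Real.exp c * ∫ y, f (true, y) ∂ν₁ := by
  have hfs : AEStronglyMeasurable f (ν₀.map (Prod.mk false)) := hf.aestronglyMeasurable
  have hft : AEStronglyMeasurable f (ν₁.map (Prod.mk true)) := hf.aestronglyMeasurable
  have hi0 : Integrable f (ν₀.map (Prod.mk false)) :=
    (integrable_map_measure hfs measurable_prodMk_left.aemeasurable).2 hf0
  have hi1 : Integrable f (ν₁.map (Prod.mk true)) :=
    (integrable_map_measure hft measurable_prodMk_left.aemeasurable).2 hf1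
  rw [jointWeight, integral_add_measure hi0 (hi1.smul_measure ENNReal.ofReal_ne_top),
    integral_smul_measure, integral_map measurable_prodMk_left.aemeasurable hfs,
    integral_map measurable_prodMk_left.aemeasurable hft, ENNReal.toReal_ofReal (Real.exp_pos c).le,
    smul_eq_mul]

/-- The indicator-weighted observable `1_target · g(state)` integrates over the joint weight to
`e^{c} ∫ g dν₁`. -/
theorem integral_jointWeight_targetLevel_indicator
    {g : Ω → ℝ} (hgm : Measurable g) (hg : Integrable g ν₁) :
    ∫ p, (targetLevel Ω).indicator (fun p : Bool × Ω => g p.2) p ∂(jointWeight c ν₀ ν₁) =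
      Real.exp c * ∫ y, g y ∂ν₁ := by
  have hmeas : Measurable ((targetLevel Ω).indicator fun p : Bool × Ω => g p.2) :=
    (hgm.comp measurable_snd).indicator measurableSet_targetLevel
  have h0 : (fun x => (targetLevel Ω).indicator (fun p : Bool × Ω => g p.2) (false, x)) =
      fun _ => 0 := by
    funext x
    exact Set.indicator_of_notMem (by simp) _
  have h1 : (fun y => (targetLevel Ω).indicator (fun p : Bool × Ω => g p.2) (true, y)) = g := by
    funext y
    exact Set.indicator_of_mem (by simp) _
  rw [integral_jointWeight_real c ν₀ ν₁ hmeas (by rw [h0]; exact integrable_zero _ _ _)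
    (by rw [h1]; exact hg), h0, h1, integral_const, smul_zero, zero_add]

/-- The indicator-weighted observable `1_prior · g(state)` integrates over the joint weight to
`∫ g dν₀`. -/
theorem integral_jointWeight_priorLevel_indicator
    {g : Ω → ℝ} (hgm : Measurable g) (hg : Integrable g ν₀) :
    ∫ p, (targetLevel Ω)ᶜ.indicator (fun p : Bool × Ω => g p.2) p ∂(jointWeight c ν₀ ν₁) =
      ∫ x, g x ∂ν₀ := by
  have hmeas : Measurable ((targetLevel Ω)ᶜ.indicator fun p : Bool × Ω => g p.2) :=
    (hgm.comp measurable_snd).indicator measurableSet_targetLevel.compl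
  have h0 : (fun x => (targetLevel Ω)ᶜ.indicator (fun p : Bool × Ω => g p.2) (false, x)) = g := by
    funext x
    exact Set.indicator_of_mem (by simp) _
  have h1 : (fun y => (targetLevel Ω)ᶜ.indicator (fun p : Bool × Ω => g p.2) (true, y)) =
      fun _ => 0 := by
    funext y
    exact Set.indicator_of_notMem (by simp) _
  rw [integral_jointWeight_real c ν₀ ν₁ hmeas (by rw [h0]; exact hg)
    (by rw [h1]; exact integrable_zero _ _ _), h0, h1, integral_const, smul_zero, mul_zero, add_zero]

/-- Integrals against the normalised joint law: `∫ f dπ_c = Π_c(everything)⁻¹ ∫ f dΠ_c`. -/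
theorem integral_jointLaw (f : Bool × Ω → ℝ) :
    ∫ p, f p ∂((jointWeight c ν₀ ν₁ univ)⁻¹ • jointWeight c ν₀ ν₁) =
      ((jointWeight c ν₀ ν₁ univ).toReal)⁻¹ * ∫ p, f p ∂(jointWeight c ν₀ ν₁) := by
  rw [integral_smul_measure, ENNReal.toReal_inv, smul_eq_mul]

end JointLaw

/-! ## The chain watched on one level -/

section Chain

variable {c : ℝ} {ν₀ ν₁ : Measure Ω} [IsFiniteMeasure ν₀] [IsFiniteMeasure ν₁]
variable (Q : Kernel (Bool × Ω) (Bool × Ω)) [IsMarkovKernel Q]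

/-- **THE CHAIN WATCHED ON THE TARGET LEVEL ESTIMATES TARGET EXPECTATIONS.**  Along an ergodic
expanded-ensemble chain, for every measurable `ν₁`-integrable observable `g` of the configuration,
the plain average of `g` over the target-level visits among the first `n` iterations converges to
`Z₁⁻¹ ∫ g dν₁` — the normalised target expectation — almost surely. -/
theorem tendsto_targetLevelMean_ae_chain (h0 : ν₀ univ ≠ 0) (h1 : ν₁ univ ≠ 0)
    (hQ : Kernel.Invariant Q (jointWeight c ν₀ ν₁))
    (hErg : haveI := isProbabilityMeasure_jointLaw c ν₀ ν₁ h0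
      Ergodic (fun (z : ℕ → Bool × Ω) (k : ℕ) => z (k + 1))
        (Kernel.trajMeasure (X := fun _ : ℕ => Bool × Ω)
          ((jointWeight c ν₀ ν₁ univ)⁻¹ • jointWeight c ν₀ ν₁)
          (fun n : ℕ => Q.comap (fun h : (j : ↥(Finset.Iic n)) → Bool × Ω =>
            h ⟨n, Finset.mem_Iic.2 le_rfl⟩) (measurable_pi_apply _))))
    {g : Ω → ℝ} (hgm : Measurable g) (hg : Integrable g ν₁) :
    haveI := isProbabilityMeasure_jointLaw c ν₀ ν₁ h0
    ∀ᵐ z ∂(Kernel.trajMeasure (X := fun _ : ℕ => Bool × Ω)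
        ((jointWeight c ν₀ ν₁ univ)⁻¹ • jointWeight c ν₀ ν₁)
        (fun n : ℕ => Q.comap (fun h : (j : ↥(Finset.Iic n)) → Bool × Ω =>
          h ⟨n, Finset.mem_Iic.2 le_rfl⟩) (measurable_pi_apply _))),
      Tendsto (fun n : ℕ =>
          (∑ i ∈ range n, (targetLevel Ω).indicator (fun p : Bool × Ω => g p.2) (z i)) /
            ∑ i ∈ range n, (targetLevel Ω).indicator (1 : Bool × Ω → ℝ) (z i))
        atTop (𝓝 (((ν₁ univ).toReal)⁻¹ * ∫ y, g y ∂ν₁)) := by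
  haveI := isProbabilityMeasure_jointLaw c ν₀ ν₁ h0
  haveI := isFiniteMeasure_jointWeight c ν₀ ν₁
  have hz1 : 0 < (ν₁ univ).toReal := ENNReal.toReal_pos h1 (measure_ne_top ν₁ univ)
  have hJ : 0 < (jointWeight c ν₀ ν₁ univ).toReal :=
    ENNReal.toReal_pos (jointWeight_univ_ne_zero c ν₀ ν₁ h0) (measure_ne_top _ _)
  have hmeas : Measurable ((targetLevel Ω).indicator fun p : Bool × Ω => g p.2) :=
    (hgm.comp measurable_snd).indicator measurableSet_targetLevel
  -- integrability of `1_target · g` under `π_c`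
  have hint : Integrable ((targetLevel Ω).indicator fun p : Bool × Ω => g p.2)
      ((jointWeight c ν₀ ν₁ univ)⁻¹ • jointWeight c ν₀ ν₁) := by
    refine Integrable.smul_measure ?_ (ENNReal.inv_ne_top.2 (jointWeight_univ_ne_zero c ν₀ ν₁ h0))
    have h0f : (fun x => (targetLevel Ω).indicator (fun p : Bool × Ω => g p.2) (false, x)) =
        fun _ => 0 := by
      funext x; exact Set.indicator_of_notMem (by simp) _
    have h1f : (fun y => (targetLevel Ω).indicator (fun p : Bool × Ω => g p.2) (true, y)) = g := by
      funext y; exact Set.indicator_of_mem (by simp) _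
    have hi0 : Integrable ((targetLevel Ω).indicator fun p : Bool × Ω => g p.2)
        (ν₀.map (Prod.mk false)) :=
      (integrable_map_measure hmeas.aestronglyMeasurable measurable_prodMk_left.aemeasurable).2
        (by rw [show ((targetLevel Ω).indicator fun p : Bool × Ω => g p.2) ∘ Prod.mk false =
          fun _ => 0 from h0f]; exact integrable_const 0)
    have hi1 : Integrable ((targetLevel Ω).indicator fun p : Bool × Ω => g p.2)
        (ν₁.map (Prod.mk true)) :=
      (integrable_map_measure hmeas.aestronglyMeasurable measurable_prodMk_left.aemeasurable).2
        (by rw [show ((targetLevel Ω).indicator fun p : Bool × Ω => g p.2) ∘ Prod.mk true = g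
          from h1f]; exact hg)
    rw [jointWeight]
    exact hi0.add_measure (hi1.smul_measure ENNReal.ofReal_ne_top)
  -- the two population means
  have ha : ∫ p, (targetLevel Ω).indicator (fun p : Bool × Ω => g p.2) p
      ∂((jointWeight c ν₀ ν₁ univ)⁻¹ • jointWeight c ν₀ ν₁) =
      ((jointWeight c ν₀ ν₁ univ).toReal)⁻¹ * (Real.exp c * ∫ y, g y ∂ν₁) := by
    rw [integral_jointLaw, integral_jointWeight_targetLevel_indicator c ν₀ ν₁ hgm hg]
  have hb : ∫ p, (targetLevel Ω).indicator (1 : Bool × Ω → ℝ) p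
      ∂((jointWeight c ν₀ ν₁ univ)⁻¹ • jointWeight c ν₀ ν₁) =
      ((jointWeight c ν₀ ν₁ univ).toReal)⁻¹ * (Real.exp c * (ν₁ univ).toReal) := by
    rw [integral_indicator_one measurableSet_targetLevel, measureReal_def, Measure.smul_apply,
      smul_eq_mul, ENNReal.toReal_mul, ENNReal.toReal_inv, toReal_jointWeight_targetLevel]
  have hb0 : ∫ p, (targetLevel Ω).indicator (1 : Bool × Ω → ℝ) p
      ∂((jointWeight c ν₀ ν₁ univ)⁻¹ • jointWeight c ν₀ ν₁) ≠ 0 := by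
    rw [hb]; positivity
  have h := tendsto_ratio_ae_of_ergodic hErg (chain_map_eval_of_invariant Q (invariant_smul Q hQ _) 0)
    hint ((memLp_targetLevel_indicator c ν₀ ν₁).integrable one_le_two) hb0
  have hval : (∫ p, (targetLevel Ω).indicator (fun p : Bool × Ω => g p.2) p
        ∂((jointWeight c ν₀ ν₁ univ)⁻¹ • jointWeight c ν₀ ν₁)) /
      ∫ p, (targetLevel Ω).indicator (1 : Bool × Ω → ℝ) p
        ∂((jointWeight c ν₀ ν₁ univ)⁻¹ • jointWeight c ν₀ ν₁) =
      ((ν₁ univ).toReal)⁻¹ * ∫ y, g y ∂ν₁ := by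
    rw [ha, hb]
    have hec : Real.exp c ≠ 0 := Real.exp_ne_zero c
    field_simp
  rw [hval] at h
  exact h

/-- **The chain watched on the PRIOR level estimates prior expectations**: the plain average of `g`
over the prior-level visits converges to `Z₀⁻¹ ∫ g dν₀` almost surely. -/
theorem tendsto_priorLevelMean_ae_chain (h0 : ν₀ univ ≠ 0)
    (hQ : Kernel.Invariant Q (jointWeight c ν₀ ν₁))
    (hErg : haveI := isProbabilityMeasure_jointLaw c ν₀ ν₁ h0
      Ergodic (fun (z : ℕ → Bool × Ω) (k : ℕ) => z (k + 1))
        (Kernel.trajMeasure (X := fun _ : ℕ => Bool × Ω)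
          ((jointWeight c ν₀ ν₁ univ)⁻¹ • jointWeight c ν₀ ν₁)
          (fun n : ℕ => Q.comap (fun h : (j : ↥(Finset.Iic n)) → Bool × Ω =>
            h ⟨n, Finset.mem_Iic.2 le_rfl⟩) (measurable_pi_apply _))))
    {g : Ω → ℝ} (hgm : Measurable g) (hg : Integrable g ν₀) :
    haveI := isProbabilityMeasure_jointLaw c ν₀ ν₁ h0
    ∀ᵐ z ∂(Kernel.trajMeasure (X := fun _ : ℕ => Bool × Ω)
        ((jointWeight c ν₀ ν₁ univ)⁻¹ • jointWeight c ν₀ ν₁)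
        (fun n : ℕ => Q.comap (fun h : (j : ↥(Finset.Iic n)) → Bool × Ω =>
          h ⟨n, Finset.mem_Iic.2 le_rfl⟩) (measurable_pi_apply _))),
      Tendsto (fun n : ℕ =>
          (∑ i ∈ range n, (targetLevel Ω)ᶜ.indicator (fun p : Bool × Ω => g p.2) (z i)) /
            ∑ i ∈ range n, (targetLevel Ω)ᶜ.indicator (1 : Bool × Ω → ℝ) (z i))
        atTop (𝓝 (((ν₀ univ).toReal)⁻¹ * ∫ x, g x ∂ν₀)) := by
  haveI := isProbabilityMeasure_jointLaw c ν₀ ν₁ h0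
  haveI := isFiniteMeasure_jointWeight c ν₀ ν₁
  have hz0 : 0 < (ν₀ univ).toReal := ENNReal.toReal_pos h0 (measure_ne_top ν₀ univ)
  have hJ : 0 < (jointWeight c ν₀ ν₁ univ).toReal :=
    ENNReal.toReal_pos (jointWeight_univ_ne_zero c ν₀ ν₁ h0) (measure_ne_top _ _)
  have hmeas : Measurable ((targetLevel Ω)ᶜ.indicator fun p : Bool × Ω => g p.2) :=
    (hgm.comp measurable_snd).indicator measurableSet_targetLevel.compl
  have hint : Integrable ((targetLevel Ω)ᶜ.indicator fun p : Bool × Ω => g p.2)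
      ((jointWeight c ν₀ ν₁ univ)⁻¹ • jointWeight c ν₀ ν₁) := by
    refine Integrable.smul_measure ?_ (ENNReal.inv_ne_top.2 (jointWeight_univ_ne_zero c ν₀ ν₁ h0))
    have h0f : (fun x => (targetLevel Ω)ᶜ.indicator (fun p : Bool × Ω => g p.2) (false, x)) = g := by
      funext x; exact Set.indicator_of_mem (by simp) _
    have h1f : (fun y => (targetLevel Ω)ᶜ.indicator (fun p : Bool × Ω => g p.2) (true, y)) =
        fun _ => 0 := by
      funext y; exact Set.indicator_of_notMem (by simp) _
    have hi0 : Integrable ((targetLevel Ω)ᶜ.indicator fun p : Bool × Ω => g p.2)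
        (ν₀.map (Prod.mk false)) :=
      (integrable_map_measure hmeas.aestronglyMeasurable measurable_prodMk_left.aemeasurable).2
        (by rw [show ((targetLevel Ω)ᶜ.indicator fun p : Bool × Ω => g p.2) ∘ Prod.mk false = g
          from h0f]; exact hg)
    have hi1 : Integrable ((targetLevel Ω)ᶜ.indicator fun p : Bool × Ω => g p.2)
        (ν₁.map (Prod.mk true)) :=
      (integrable_map_measure hmeas.aestronglyMeasurable measurable_prodMk_left.aemeasurable).2
        (by rw [show ((targetLevel Ω)ᶜ.indicator fun p : Bool × Ω => g p.2) ∘ Prod.mk true =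
          fun _ => 0 from h1f]; exact integrable_const 0)
    rw [jointWeight]
    exact hi0.add_measure (hi1.smul_measure ENNReal.ofReal_ne_top)
  have hone : Integrable ((targetLevel Ω)ᶜ.indicator (1 : Bool × Ω → ℝ))
      ((jointWeight c ν₀ ν₁ univ)⁻¹ • jointWeight c ν₀ ν₁) :=
    (integrable_const 1).indicator measurableSet_targetLevel.compl
  have ha : ∫ p, (targetLevel Ω)ᶜ.indicator (fun p : Bool × Ω => g p.2) p
      ∂((jointWeight c ν₀ ν₁ univ)⁻¹ • jointWeight c ν₀ ν₁) =
      ((jointWeight c ν₀ ν₁ univ).toReal)⁻¹ * ∫ x, g x ∂ν₀ := by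
    rw [integral_jointLaw, integral_jointWeight_priorLevel_indicator c ν₀ ν₁ hgm hg]
  have hb : ∫ p, (targetLevel Ω)ᶜ.indicator (1 : Bool × Ω → ℝ) p
      ∂((jointWeight c ν₀ ν₁ univ)⁻¹ • jointWeight c ν₀ ν₁) =
      ((jointWeight c ν₀ ν₁ univ).toReal)⁻¹ * (ν₀ univ).toReal := by
    rw [integral_indicator_one measurableSet_targetLevel.compl, measureReal_def, Measure.smul_apply,
      smul_eq_mul, ENNReal.toReal_mul, ENNReal.toReal_inv, jointWeight_compl_targetLevel]
  have hb0 : ∫ p, (targetLevel Ω)ᶜ.indicator (1 : Bool × Ω → ℝ) p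
      ∂((jointWeight c ν₀ ν₁ univ)⁻¹ • jointWeight c ν₀ ν₁) ≠ 0 := by
    rw [hb]; positivity
  have h := tendsto_ratio_ae_of_ergodic hErg (chain_map_eval_of_invariant Q (invariant_smul Q hQ _) 0)
    hint hone hb0
  have hval : (∫ p, (targetLevel Ω)ᶜ.indicator (fun p : Bool × Ω => g p.2) p
        ∂((jointWeight c ν₀ ν₁ univ)⁻¹ • jointWeight c ν₀ ν₁)) /
      ∫ p, (targetLevel Ω)ᶜ.indicator (1 : Bool × Ω → ℝ) p
        ∂((jointWeight c ν₀ ν₁ univ)⁻¹ • jointWeight c ν₀ ν₁) =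
      ((ν₀ univ).toReal)⁻¹ * ∫ x, g x ∂ν₀ := by
    rw [ha, hb]
    field_simp
  rw [hval] at h
  exact h

end Chain

end Summit.Ventures.LatticeQCDFlow.Exactness.GeneralNCMC
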